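import Summits.Parity.GeneralizedHardyLittlewood.Theses.RealCharacterThetaLadder
import Literature.NumberTheory.LFunctions.NoRealZeroTruncationBaseIV
import Literature.NumberTheory.LFunctions.NoRealZeroTruncationBaseV
import Literature.NumberTheory.LFunctions.NoRealZeroTruncationBaseVI
import Literature.NumberTheory.LFunctions.NoRealZeroTruncationBaseVII
import Literature.NumberTheory.LFunctions.NoRealZeroTruncationBaseVIII
import Literature.NumberTheory.LFunctions.NoRealZeroUpToPositivity
import Literature.NumberTheory.LFunctions.ClassGroupLFunctionNoExceptionalZeroUpTo
import Literature.NumberTheory.LFunctions.IllusoryHypothesesExcludedUpTo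

/-!
# Route `RealCharacterThetaLadder`, item `PlattRange` — what the KERNEL wide base gives the consumers,
# unconditionally, second file (levels `3000` and beyond)

Cell `parity-realchar` (summit Parity, column REALCHAR), kernel side; `TARGET.md §2 row 19` / `CONSUMERS.md`
§P3, §W1, §W2, §C4′, §C4.  Continuation of `RealCharacterThetaLadderKernelBase.lean` (levels `231 / 436 / 1100 /
2000`, at the 400-line limit): the by-name UNCONDITIONAL consumers of the hypothesis-free wide base
`noRealZeroUpTo_3000 : NoRealZeroUpTo 3000` (`NoRealZeroTruncationBaseIV.lean`: Davenport–Chua one-period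
truncation certificates decided in the kernel for every primitive quadratic character of conductor `≤ 3000`,
standard axioms, no named fact, no numerics of record):

* `kernelWide_plattRange_restrict_3000` — `PlattRange` (`= NoRealZeroUpTo 400000`, the support item, closed in the
  route's own currency by certified numerics) restricted to `q ≤ 3000` holds outright;
* `kernelWide_lfunction_re_pos_3000` / `kernelWide_centralValue_pos_3000` (W1) — `Re L(σ, χ) > 0` for every real
  `σ > 0`, in particular `L(1/2, χ) > 0`, for every quadratic `χ ≠ χ₀` (primitive or not) mod `q ≤ 3000`;
* `kernelWide_dedekindZeta_quadratic_ne_zero_3000` (W2) — `ζ_k(σ) ≠ 0` on `(0, 1)` for every quadratic field `k`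
  with `|d_k| ≤ 3000`;
* `kernelWide_dedekindZeta_starkWindow_of_quadraticSubfields_3000` (C4′, wide) and
  `kernelWide_classGroupLFunction_ne_zero_3000` (C4);
* `kernelWide_not_isSiegelZero_3000` — no Siegel zero of any quality at conductors `3 ≤ q ≤ 3000`.

WHAT THIS IS NOT: nothing beyond `3000`; 7 orders of magnitude below the instrument (`3·10¹⁰`); no Parity credit
(cell rule H5).
-/

noncomputable section

namespace Summit.Parity.GeneralizedHardyLittlewood.Theorems

open Literature.NumberTheory.LFunctions Literature.NumberTheory.LFunctions.NumberField
  Literature.NumberTheory.QuadraticFields Literature.Barriers.Parity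

/-! ## Level `3000` (2026-08-27): BOTH parities at `3000` (truncation certificates, blocks
`2001 … 3000`; `noRealZeroUpTo_3000` of `NoRealZeroTruncationBaseIV.lean`, cell seat prover g9)

The consumers of `RealCharacterThetaLadderKernelBase.lean`, verbatim at level `3000`. -/

/-- **`PlattRange` restricted to `q ≤ 3000` holds in the kernel**, both parities: for every modulus `3 ≤ q ≤ 3000`,
every primitive quadratic `χ` mod `q` and every `σ ∈ (0, 1)`, `L(σ, χ) ≠ 0` — unconditionally. -/
theorem kernelWide_plattRange_restrict_3000 :
    ∀ (q : ℕ) [NeZero q], 3 ≤ q → q ≤ 3000 →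
      ∀ χ : DirichletCharacter ℂ q, χ.IsQuadratic → χ.IsPrimitive →
        ∀ σ : ℝ, 0 < σ → σ < 1 → χ.LFunction σ ≠ 0 :=
  noRealZeroUpTo_3000

/-- **Positivity on `(0, ∞)`, UNCONDITIONAL, `q ≤ 3000`**: for every quadratic `χ ≠ χ₀` mod `q ≤ 3000`
(primitive or not) and every real `σ > 0`, `Re L(σ, χ) > 0`. -/
theorem kernelWide_lfunction_re_pos_3000 {q : ℕ} [NeZero q] (hqQ : q ≤ 3000) (χ : DirichletCharacter ℂ q)
    (hquad : χ.IsQuadratic) (hχ : χ ≠ 1) {σ : ℝ} (hσ : 0 < σ) : 0 < (χ.LFunction σ).re :=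
  noRealZeroUpTo_3000.lfunction_re_pos hqQ χ hquad hχ hσ

/-- **Central values, UNCONDITIONAL (consumer W1), `q ≤ 3000`**: `L(1/2, χ) > 0` for every quadratic
`χ ≠ χ₀` mod `q ≤ 3000`. -/
theorem kernelWide_centralValue_pos_3000 {q : ℕ} [NeZero q] (hqQ : q ≤ 3000) (χ : DirichletCharacter ℂ q)
    (hquad : χ.IsQuadratic) (hχ : χ ≠ 1) : 0 < (χ.LFunction (1 / 2 : ℝ)).re :=
  noRealZeroUpTo_3000.lfunction_one_half_pos hqQ χ hquad hχ

/-- **No real zero of a quadratic Dedekind zeta function in `(0, 1)`, UNCONDITIONAL (consumer W2),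
`|d_k| ≤ 3000`**. -/
theorem kernelWide_dedekindZeta_quadratic_ne_zero_3000 (k : Type) [Field k] [NumberField k]
    (h2 : Module.finrank ℚ k = 2) (hkQ : (NumberField.discr k).natAbs ≤ 3000) {σ : ℝ} (hσ0 : 0 < σ)
    (hσ1 : σ < 1) : Literature.NumberTheory.LFunctions.dedekindZetaCont k σ ≠ 0 := by
  intro h0
  obtain ⟨M, _, κ, hM, hM3, -, hsq, hprim, hLz⟩ :=
    Quadratic.exists_primitive_LFunction_eq_zero_of_realZero h2 hσ0 hσ1 h0
  subst hM
  exact noRealZeroUpTo_3000 _ hM3 hkQ κ (MulChar.isQuadratic_iff_sq_eq_one.mpr hsq) hprim σ hσ0 hσ1 hLz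

/-- **Stark's whole window is zero-free for every number field whose quadratic subfields have
`|d_k| ≤ 3000`, UNCONDITIONAL (consumer C4′, wide form)**. -/
theorem kernelWide_dedekindZeta_starkWindow_of_quadraticSubfields_3000 (K : Type) [Field K]
    [NumberField K] (hK : 1 < Module.finrank ℚ K)
    (hQ : ∀ k : IntermediateField ℚ K, Module.finrank ℚ k = 2 → (NumberField.discr k).natAbs ≤ 3000)
    {σ : ℝ} (hσ : 1 - 1 / (4 * ((Module.finrank ℚ K).factorial : ℝ) *
      Real.log ((NumberField.discr K).natAbs : ℝ)) ≤ σ) (hσ1 : σ < 1) :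
    Literature.NumberTheory.LFunctions.dedekindZetaCont K σ ≠ 0 :=
  dedekindZetaCont_ne_zero_of_noRealZeroUpTo_of_quadraticSubfields noRealZeroUpTo_3000 K hK hQ hσ hσ1

/-- **Real class group `L`-functions of fields with `|d_K| ≤ 3000`, UNCONDITIONAL (consumer C4)**. -/
theorem kernelWide_classGroupLFunction_ne_zero_3000 (K : Type) [Field K] [NumberField K]
    (hK : 1 < Module.finrank ℚ K) (hdQ : (NumberField.discr K).natAbs ≤ 3000)
    (χ : ClassGroup (NumberField.RingOfIntegers K) →* ℂˣ) (hχ : χ * χ = 1) {σ : ℝ}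
    (hσ : 1 - 1 / (8 * ((2 * Module.finrank ℚ K).factorial : ℝ) *
      Real.log ((NumberField.discr K).natAbs : ℝ)) ≤ σ) (hσ1 : σ < 1) :
    classGroupLFunction K χ σ ≠ 0 :=
  classGroupLFunction_ne_zero_of_noRealZeroUpTo noRealZeroUpTo_3000 K hK hdQ χ hχ hσ hσ1

/-- **No Siegel zero of any quality at conductors `3 ≤ q ≤ 3000`, UNCONDITIONAL**. -/
theorem kernelWide_not_isSiegelZero_3000 {q : ℕ} [NeZero q] (hq3 : 3 ≤ q) (hqQ : q ≤ 3000)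
    (χ : DirichletCharacter ℂ q) (η : ℝ) : ¬ IsSiegelZero χ η :=
  not_isSiegelZero_of_noRealZeroUpTo noRealZeroUpTo_3000 hq3 hqQ χ η

/-! ## Level `4000` (append-only section, 2026-08-27): BOTH parities at `4000` (truncation certificates, blocks
`3001 … 4000` on top of level `3000`; `noRealZeroUpTo_4000` of `NoRealZeroTruncationBaseV.lean`, cell seat prover g9)

The consumers of `RealCharacterThetaLadderKernelBase.lean`, verbatim at level `4000`. -/

/-- **`PlattRange` restricted to `q ≤ 4000` holds in the kernel**, both parities: for every modulus `3 ≤ q ≤ 4000`,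
every primitive quadratic `χ` mod `q` and every `σ ∈ (0, 1)`, `L(σ, χ) ≠ 0` — unconditionally. -/
theorem kernelWide_plattRange_restrict_4000 :
    ∀ (q : ℕ) [NeZero q], 3 ≤ q → q ≤ 4000 →
      ∀ χ : DirichletCharacter ℂ q, χ.IsQuadratic → χ.IsPrimitive →
        ∀ σ : ℝ, 0 < σ → σ < 1 → χ.LFunction σ ≠ 0 :=
  noRealZeroUpTo_4000

/-- **Positivity on `(0, ∞)`, UNCONDITIONAL, `q ≤ 4000`**: for every quadratic `χ ≠ χ₀` mod `q ≤ 4000`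
(primitive or not) and every real `σ > 0`, `Re L(σ, χ) > 0`. -/
theorem kernelWide_lfunction_re_pos_4000 {q : ℕ} [NeZero q] (hqQ : q ≤ 4000) (χ : DirichletCharacter ℂ q)
    (hquad : χ.IsQuadratic) (hχ : χ ≠ 1) {σ : ℝ} (hσ : 0 < σ) : 0 < (χ.LFunction σ).re :=
  noRealZeroUpTo_4000.lfunction_re_pos hqQ χ hquad hχ hσ

/-- **Central values, UNCONDITIONAL (consumer W1), `q ≤ 4000`**: `L(1/2, χ) > 0` for every quadratic
`χ ≠ χ₀` mod `q ≤ 4000`. -/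
theorem kernelWide_centralValue_pos_4000 {q : ℕ} [NeZero q] (hqQ : q ≤ 4000) (χ : DirichletCharacter ℂ q)
    (hquad : χ.IsQuadratic) (hχ : χ ≠ 1) : 0 < (χ.LFunction (1 / 2 : ℝ)).re :=
  noRealZeroUpTo_4000.lfunction_one_half_pos hqQ χ hquad hχ

/-- **No real zero of a quadratic Dedekind zeta function in `(0, 1)`, UNCONDITIONAL (consumer W2),
`|d_k| ≤ 4000`**. -/
theorem kernelWide_dedekindZeta_quadratic_ne_zero_4000 (k : Type) [Field k] [NumberField k]
    (h2 : Module.finrank ℚ k = 2) (hkQ : (NumberField.discr k).natAbs ≤ 4000) {σ : ℝ} (hσ0 : 0 < σ)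
    (hσ1 : σ < 1) : Literature.NumberTheory.LFunctions.dedekindZetaCont k σ ≠ 0 := by
  intro h0
  obtain ⟨M, _, κ, hM, hM3, -, hsq, hprim, hLz⟩ :=
    Quadratic.exists_primitive_LFunction_eq_zero_of_realZero h2 hσ0 hσ1 h0
  subst hM
  exact noRealZeroUpTo_4000 _ hM3 hkQ κ (MulChar.isQuadratic_iff_sq_eq_one.mpr hsq) hprim σ hσ0 hσ1 hLz

/-- **Stark's whole window is zero-free for every number field whose quadratic subfields have
`|d_k| ≤ 4000`, UNCONDITIONAL (consumer C4′, wide form)**. -/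
theorem kernelWide_dedekindZeta_starkWindow_of_quadraticSubfields_4000 (K : Type) [Field K]
    [NumberField K] (hK : 1 < Module.finrank ℚ K)
    (hQ : ∀ k : IntermediateField ℚ K, Module.finrank ℚ k = 2 → (NumberField.discr k).natAbs ≤ 4000)
    {σ : ℝ} (hσ : 1 - 1 / (4 * ((Module.finrank ℚ K).factorial : ℝ) *
      Real.log ((NumberField.discr K).natAbs : ℝ)) ≤ σ) (hσ1 : σ < 1) :
    Literature.NumberTheory.LFunctions.dedekindZetaCont K σ ≠ 0 :=
  dedekindZetaCont_ne_zero_of_noRealZeroUpTo_of_quadraticSubfields noRealZeroUpTo_4000 K hK hQ hσ hσ1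

/-- **Real class group `L`-functions of fields with `|d_K| ≤ 4000`, UNCONDITIONAL (consumer C4)**. -/
theorem kernelWide_classGroupLFunction_ne_zero_4000 (K : Type) [Field K] [NumberField K]
    (hK : 1 < Module.finrank ℚ K) (hdQ : (NumberField.discr K).natAbs ≤ 4000)
    (χ : ClassGroup (NumberField.RingOfIntegers K) →* ℂˣ) (hχ : χ * χ = 1) {σ : ℝ}
    (hσ : 1 - 1 / (8 * ((2 * Module.finrank ℚ K).factorial : ℝ) *
      Real.log ((NumberField.discr K).natAbs : ℝ)) ≤ σ) (hσ1 : σ < 1) :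
    classGroupLFunction K χ σ ≠ 0 :=
  classGroupLFunction_ne_zero_of_noRealZeroUpTo noRealZeroUpTo_4000 K hK hdQ χ hχ hσ hσ1

/-- **No Siegel zero of any quality at conductors `3 ≤ q ≤ 4000`, UNCONDITIONAL**. -/
theorem kernelWide_not_isSiegelZero_4000 {q : ℕ} [NeZero q] (hq3 : 3 ≤ q) (hqQ : q ≤ 4000)
    (χ : DirichletCharacter ℂ q) (η : ℝ) : ¬ IsSiegelZero χ η :=
  not_isSiegelZero_of_noRealZeroUpTo noRealZeroUpTo_4000 hq3 hqQ χ η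

/-! ## Level `5000` (append-only section, 2026-08-27): BOTH parities at `5000` (truncation certificates, blocks
`4001 … 5000` on top of level `4000`; `noRealZeroUpTo_5000` of `NoRealZeroTruncationBaseVI.lean`, cell seat prover g9)

The consumers of `RealCharacterThetaLadderKernelBase.lean`, verbatim at level `5000`. -/

/-- **`PlattRange` restricted to `q ≤ 5000` holds in the kernel**, both parities: for every modulus `3 ≤ q ≤ 5000`,
every primitive quadratic `χ` mod `q` and every `σ ∈ (0, 1)`, `L(σ, χ) ≠ 0` — unconditionally. -/
theorem kernelWide_plattRange_restrict_5000 :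
    ∀ (q : ℕ) [NeZero q], 3 ≤ q → q ≤ 5000 →
      ∀ χ : DirichletCharacter ℂ q, χ.IsQuadratic → χ.IsPrimitive →
        ∀ σ : ℝ, 0 < σ → σ < 1 → χ.LFunction σ ≠ 0 :=
  noRealZeroUpTo_5000

/-- **Positivity on `(0, ∞)`, UNCONDITIONAL, `q ≤ 5000`**: for every quadratic `χ ≠ χ₀` mod `q ≤ 5000`
(primitive or not) and every real `σ > 0`, `Re L(σ, χ) > 0`. -/
theorem kernelWide_lfunction_re_pos_5000 {q : ℕ} [NeZero q] (hqQ : q ≤ 5000) (χ : DirichletCharacter ℂ q)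
    (hquad : χ.IsQuadratic) (hχ : χ ≠ 1) {σ : ℝ} (hσ : 0 < σ) : 0 < (χ.LFunction σ).re :=
  noRealZeroUpTo_5000.lfunction_re_pos hqQ χ hquad hχ hσ

/-- **Central values, UNCONDITIONAL (consumer W1), `q ≤ 5000`**: `L(1/2, χ) > 0` for every quadratic
`χ ≠ χ₀` mod `q ≤ 5000`. -/
theorem kernelWide_centralValue_pos_5000 {q : ℕ} [NeZero q] (hqQ : q ≤ 5000) (χ : DirichletCharacter ℂ q)
    (hquad : χ.IsQuadratic) (hχ : χ ≠ 1) : 0 < (χ.LFunction (1 / 2 : ℝ)).re :=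
  noRealZeroUpTo_5000.lfunction_one_half_pos hqQ χ hquad hχ

/-- **No real zero of a quadratic Dedekind zeta function in `(0, 1)`, UNCONDITIONAL (consumer W2),
`|d_k| ≤ 5000`**. -/
theorem kernelWide_dedekindZeta_quadratic_ne_zero_5000 (k : Type) [Field k] [NumberField k]
    (h2 : Module.finrank ℚ k = 2) (hkQ : (NumberField.discr k).natAbs ≤ 5000) {σ : ℝ} (hσ0 : 0 < σ)
    (hσ1 : σ < 1) : Literature.NumberTheory.LFunctions.dedekindZetaCont k σ ≠ 0 := by
  intro h0
  obtain ⟨M, _, κ, hM, hM3, -, hsq, hprim, hLz⟩ :=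
    Quadratic.exists_primitive_LFunction_eq_zero_of_realZero h2 hσ0 hσ1 h0
  subst hM
  exact noRealZeroUpTo_5000 _ hM3 hkQ κ (MulChar.isQuadratic_iff_sq_eq_one.mpr hsq) hprim σ hσ0 hσ1 hLz

/-- **Stark's whole window is zero-free for every number field whose quadratic subfields have
`|d_k| ≤ 5000`, UNCONDITIONAL (consumer C4′, wide form)**. -/
theorem kernelWide_dedekindZeta_starkWindow_of_quadraticSubfields_5000 (K : Type) [Field K]
    [NumberField K] (hK : 1 < Module.finrank ℚ K)
    (hQ : ∀ k : IntermediateField ℚ K, Module.finrank ℚ k = 2 → (NumberField.discr k).natAbs ≤ 5000)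
    {σ : ℝ} (hσ : 1 - 1 / (4 * ((Module.finrank ℚ K).factorial : ℝ) *
      Real.log ((NumberField.discr K).natAbs : ℝ)) ≤ σ) (hσ1 : σ < 1) :
    Literature.NumberTheory.LFunctions.dedekindZetaCont K σ ≠ 0 :=
  dedekindZetaCont_ne_zero_of_noRealZeroUpTo_of_quadraticSubfields noRealZeroUpTo_5000 K hK hQ hσ hσ1

/-- **Real class group `L`-functions of fields with `|d_K| ≤ 5000`, UNCONDITIONAL (consumer C4)**. -/
theorem kernelWide_classGroupLFunction_ne_zero_5000 (K : Type) [Field K] [NumberField K]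
    (hK : 1 < Module.finrank ℚ K) (hdQ : (NumberField.discr K).natAbs ≤ 5000)
    (χ : ClassGroup (NumberField.RingOfIntegers K) →* ℂˣ) (hχ : χ * χ = 1) {σ : ℝ}
    (hσ : 1 - 1 / (8 * ((2 * Module.finrank ℚ K).factorial : ℝ) *
      Real.log ((NumberField.discr K).natAbs : ℝ)) ≤ σ) (hσ1 : σ < 1) :
    classGroupLFunction K χ σ ≠ 0 :=
  classGroupLFunction_ne_zero_of_noRealZeroUpTo noRealZeroUpTo_5000 K hK hdQ χ hχ hσ hσ1

/-- **No Siegel zero of any quality at conductors `3 ≤ q ≤ 5000`, UNCONDITIONAL**. -/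
theorem kernelWide_not_isSiegelZero_5000 {q : ℕ} [NeZero q] (hq3 : 3 ≤ q) (hqQ : q ≤ 5000)
    (χ : DirichletCharacter ℂ q) (η : ℝ) : ¬ IsSiegelZero χ η :=
  not_isSiegelZero_of_noRealZeroUpTo noRealZeroUpTo_5000 hq3 hqQ χ η

/-! ## Level `6000` (append-only section, 2026-08-27): BOTH parities at `6000` (truncation certificates, blocks
`5001 … 6000` on top of level `5000`; `noRealZeroUpTo_6000` of `NoRealZeroTruncationBaseVII.lean`, cell seat prover g9)

The consumers of `RealCharacterThetaLadderKernelBase.lean`, verbatim at level `6000`. -/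

/-- **`PlattRange` restricted to `q ≤ 6000` holds in the kernel**, both parities: for every modulus `3 ≤ q ≤ 6000`,
every primitive quadratic `χ` mod `q` and every `σ ∈ (0, 1)`, `L(σ, χ) ≠ 0` — unconditionally. -/
theorem kernelWide_plattRange_restrict_6000 :
    ∀ (q : ℕ) [NeZero q], 3 ≤ q → q ≤ 6000 →
      ∀ χ : DirichletCharacter ℂ q, χ.IsQuadratic → χ.IsPrimitive →
        ∀ σ : ℝ, 0 < σ → σ < 1 → χ.LFunction σ ≠ 0 :=
  noRealZeroUpTo_6000

/-- **Positivity on `(0, ∞)`, UNCONDITIONAL, `q ≤ 6000`**: for every quadratic `χ ≠ χ₀` mod `q ≤ 6000`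
(primitive or not) and every real `σ > 0`, `Re L(σ, χ) > 0`. -/
theorem kernelWide_lfunction_re_pos_6000 {q : ℕ} [NeZero q] (hqQ : q ≤ 6000) (χ : DirichletCharacter ℂ q)
    (hquad : χ.IsQuadratic) (hχ : χ ≠ 1) {σ : ℝ} (hσ : 0 < σ) : 0 < (χ.LFunction σ).re :=
  noRealZeroUpTo_6000.lfunction_re_pos hqQ χ hquad hχ hσ

/-- **Central values, UNCONDITIONAL (consumer W1), `q ≤ 6000`**: `L(1/2, χ) > 0` for every quadratic
`χ ≠ χ₀` mod `q ≤ 6000`. -/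
theorem kernelWide_centralValue_pos_6000 {q : ℕ} [NeZero q] (hqQ : q ≤ 6000) (χ : DirichletCharacter ℂ q)
    (hquad : χ.IsQuadratic) (hχ : χ ≠ 1) : 0 < (χ.LFunction (1 / 2 : ℝ)).re :=
  noRealZeroUpTo_6000.lfunction_one_half_pos hqQ χ hquad hχ

/-- **No real zero of a quadratic Dedekind zeta function in `(0, 1)`, UNCONDITIONAL (consumer W2),
`|d_k| ≤ 6000`**. -/
theorem kernelWide_dedekindZeta_quadratic_ne_zero_6000 (k : Type) [Field k] [NumberField k]
    (h2 : Module.finrank ℚ k = 2) (hkQ : (NumberField.discr k).natAbs ≤ 6000) {σ : ℝ} (hσ0 : 0 < σ)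
    (hσ1 : σ < 1) : Literature.NumberTheory.LFunctions.dedekindZetaCont k σ ≠ 0 := by
  intro h0
  obtain ⟨M, _, κ, hM, hM3, -, hsq, hprim, hLz⟩ :=
    Quadratic.exists_primitive_LFunction_eq_zero_of_realZero h2 hσ0 hσ1 h0
  subst hM
  exact noRealZeroUpTo_6000 _ hM3 hkQ κ (MulChar.isQuadratic_iff_sq_eq_one.mpr hsq) hprim σ hσ0 hσ1 hLz

/-- **Stark's whole window is zero-free for every number field whose quadratic subfields have
`|d_k| ≤ 6000`, UNCONDITIONAL (consumer C4′, wide form)**. -/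
theorem kernelWide_dedekindZeta_starkWindow_of_quadraticSubfields_6000 (K : Type) [Field K]
    [NumberField K] (hK : 1 < Module.finrank ℚ K)
    (hQ : ∀ k : IntermediateField ℚ K, Module.finrank ℚ k = 2 → (NumberField.discr k).natAbs ≤ 6000)
    {σ : ℝ} (hσ : 1 - 1 / (4 * ((Module.finrank ℚ K).factorial : ℝ) *
      Real.log ((NumberField.discr K).natAbs : ℝ)) ≤ σ) (hσ1 : σ < 1) :
    Literature.NumberTheory.LFunctions.dedekindZetaCont K σ ≠ 0 :=
  dedekindZetaCont_ne_zero_of_noRealZeroUpTo_of_quadraticSubfields noRealZeroUpTo_6000 K hK hQ hσ hσ1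

/-- **Real class group `L`-functions of fields with `|d_K| ≤ 6000`, UNCONDITIONAL (consumer C4)**. -/
theorem kernelWide_classGroupLFunction_ne_zero_6000 (K : Type) [Field K] [NumberField K]
    (hK : 1 < Module.finrank ℚ K) (hdQ : (NumberField.discr K).natAbs ≤ 6000)
    (χ : ClassGroup (NumberField.RingOfIntegers K) →* ℂˣ) (hχ : χ * χ = 1) {σ : ℝ}
    (hσ : 1 - 1 / (8 * ((2 * Module.finrank ℚ K).factorial : ℝ) *
      Real.log ((NumberField.discr K).natAbs : ℝ)) ≤ σ) (hσ1 : σ < 1) :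
    classGroupLFunction K χ σ ≠ 0 :=
  classGroupLFunction_ne_zero_of_noRealZeroUpTo noRealZeroUpTo_6000 K hK hdQ χ hχ hσ hσ1

/-- **No Siegel zero of any quality at conductors `3 ≤ q ≤ 6000`, UNCONDITIONAL**. -/
theorem kernelWide_not_isSiegelZero_6000 {q : ℕ} [NeZero q] (hq3 : 3 ≤ q) (hqQ : q ≤ 6000)
    (χ : DirichletCharacter ℂ q) (η : ℝ) : ¬ IsSiegelZero χ η :=
  not_isSiegelZero_of_noRealZeroUpTo noRealZeroUpTo_6000 hq3 hqQ χ η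

/-! ## Level `7000` (append-only section, 2026-08-27): BOTH parities at `7000` (truncation certificates, blocks
`6001 … 7000` on top of level `6000`; `noRealZeroUpTo_7000` of `NoRealZeroTruncationBaseVIII.lean`, blocks and assembly by
cell seat prover g9, section appended by prover g10)

The consumers of `RealCharacterThetaLadderKernelBase.lean`, verbatim at level `7000`. -/

/-- **`PlattRange` restricted to `q ≤ 7000` holds in the kernel**, both parities: for every modulus `3 ≤ q ≤ 7000`,
every primitive quadratic `χ` mod `q` and every `σ ∈ (0, 1)`, `L(σ, χ) ≠ 0` — unconditionally. -/
theorem kernelWide_plattRange_restrict_7000 :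
    ∀ (q : ℕ) [NeZero q], 3 ≤ q → q ≤ 7000 →
      ∀ χ : DirichletCharacter ℂ q, χ.IsQuadratic → χ.IsPrimitive →
        ∀ σ : ℝ, 0 < σ → σ < 1 → χ.LFunction σ ≠ 0 :=
  noRealZeroUpTo_7000

/-- **Positivity on `(0, ∞)`, UNCONDITIONAL, `q ≤ 7000`**: for every quadratic `χ ≠ χ₀` mod `q ≤ 7000`
(primitive or not) and every real `σ > 0`, `Re L(σ, χ) > 0`. -/
theorem kernelWide_lfunction_re_pos_7000 {q : ℕ} [NeZero q] (hqQ : q ≤ 7000) (χ : DirichletCharacter ℂ q)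
    (hquad : χ.IsQuadratic) (hχ : χ ≠ 1) {σ : ℝ} (hσ : 0 < σ) : 0 < (χ.LFunction σ).re :=
  noRealZeroUpTo_7000.lfunction_re_pos hqQ χ hquad hχ hσ

/-- **Central values, UNCONDITIONAL (consumer W1), `q ≤ 7000`**: `L(1/2, χ) > 0` for every quadratic
`χ ≠ χ₀` mod `q ≤ 7000`. -/
theorem kernelWide_centralValue_pos_7000 {q : ℕ} [NeZero q] (hqQ : q ≤ 7000) (χ : DirichletCharacter ℂ q)
    (hquad : χ.IsQuadratic) (hχ : χ ≠ 1) : 0 < (χ.LFunction (1 / 2 : ℝ)).re :=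
  noRealZeroUpTo_7000.lfunction_one_half_pos hqQ χ hquad hχ

/-- **No real zero of a quadratic Dedekind zeta function in `(0, 1)`, UNCONDITIONAL (consumer W2),
`|d_k| ≤ 7000`**. -/
theorem kernelWide_dedekindZeta_quadratic_ne_zero_7000 (k : Type) [Field k] [NumberField k]
    (h2 : Module.finrank ℚ k = 2) (hkQ : (NumberField.discr k).natAbs ≤ 7000) {σ : ℝ} (hσ0 : 0 < σ)
    (hσ1 : σ < 1) : Literature.NumberTheory.LFunctions.dedekindZetaCont k σ ≠ 0 := by
  intro h0
  obtain ⟨M, _, κ, hM, hM3, -, hsq, hprim, hLz⟩ :=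
    Quadratic.exists_primitive_LFunction_eq_zero_of_realZero h2 hσ0 hσ1 h0
  subst hM
  exact noRealZeroUpTo_7000 _ hM3 hkQ κ (MulChar.isQuadratic_iff_sq_eq_one.mpr hsq) hprim σ hσ0 hσ1 hLz

/-- **Stark's whole window is zero-free for every number field whose quadratic subfields have
`|d_k| ≤ 7000`, UNCONDITIONAL (consumer C4′, wide form)**. -/
theorem kernelWide_dedekindZeta_starkWindow_of_quadraticSubfields_7000 (K : Type) [Field K]
    [NumberField K] (hK : 1 < Module.finrank ℚ K)
    (hQ : ∀ k : IntermediateField ℚ K, Module.finrank ℚ k = 2 → (NumberField.discr k).natAbs ≤ 7000)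
    {σ : ℝ} (hσ : 1 - 1 / (4 * ((Module.finrank ℚ K).factorial : ℝ) *
      Real.log ((NumberField.discr K).natAbs : ℝ)) ≤ σ) (hσ1 : σ < 1) :
    Literature.NumberTheory.LFunctions.dedekindZetaCont K σ ≠ 0 :=
  dedekindZetaCont_ne_zero_of_noRealZeroUpTo_of_quadraticSubfields noRealZeroUpTo_7000 K hK hQ hσ hσ1

/-- **Real class group `L`-functions of fields with `|d_K| ≤ 7000`, UNCONDITIONAL (consumer C4)**. -/
theorem kernelWide_classGroupLFunction_ne_zero_7000 (K : Type) [Field K] [NumberField K]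
    (hK : 1 < Module.finrank ℚ K) (hdQ : (NumberField.discr K).natAbs ≤ 7000)
    (χ : ClassGroup (NumberField.RingOfIntegers K) →* ℂˣ) (hχ : χ * χ = 1) {σ : ℝ}
    (hσ : 1 - 1 / (8 * ((2 * Module.finrank ℚ K).factorial : ℝ) *
      Real.log ((NumberField.discr K).natAbs : ℝ)) ≤ σ) (hσ1 : σ < 1) :
    classGroupLFunction K χ σ ≠ 0 :=
  classGroupLFunction_ne_zero_of_noRealZeroUpTo noRealZeroUpTo_7000 K hK hdQ χ hχ hσ hσ1

/-- **No Siegel zero of any quality at conductors `3 ≤ q ≤ 7000`, UNCONDITIONAL**. -/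
theorem kernelWide_not_isSiegelZero_7000 {q : ℕ} [NeZero q] (hq3 : 3 ≤ q) (hqQ : q ≤ 7000)
    (χ : DirichletCharacter ℂ q) (η : ℝ) : ¬ IsSiegelZero χ η :=
  not_isSiegelZero_of_noRealZeroUpTo noRealZeroUpTo_7000 hq3 hqQ χ η

end Summit.Parity.GeneralizedHardyLittlewood.Theorems

end
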